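import Summits.Ventures.Crystal3D.Theorems.StickyWulffConstantPolycrystalWulffBoundAggNamedStaticA
import Summits.Ventures.Crystal3D.Theorems.StickyWulffConstantPolycrystalWulffBoundAggNamedStaticB
import Summits.Ventures.Crystal3D.Theorems.StickyWulffConstantPolycrystalWulffBoundAggNamedMovesA
import Summits.Ventures.Crystal3D.Theorems.StickyWulffConstantPolycrystalWulffBoundAggNamedMovesB
import Summits.Ventures.Crystal3D.Theorems.StickyWulffConstantPolycrystalWulffBoundAggScaled

/-!
# `PolycrystalWulffBound`, line `PolyDensity`: the aggregated LP bound at class level (all `m ≥ 4`)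

Route `StickyWulffConstant` of the venture `Summits/Ventures/Crystal3D`, crux `PolycrystalWulffBound`
(item `stmt-Ventures-19482`), second prover lane (poly-p2, gen 7).  `aggLP_bound`: for ANY finite class type
`β` with class variables `F, Y, Acl, v` (free energies, free areas, cross-class interfaces, volumes) satisfying
the generic class rows of the middle-band programme — floors, shaved/unshaved Wulff blocks, ball blocks,
isoperimetry, singles sums (`aggStaticRows`), the walls row, and the class-level recolour / delete
inequalities (`rec_row_classes` / `del_row_classes`, i.e. the induction hypothesis on the number of
classes) — and three distinguished classes `a, b, c` carrying the three largest volumes, none above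
`17/20` of the total, with a non-empty remainder: the computational hypothesis `AggCert27_8` (CH-P3) gives
`6·2^{1/3}(√2 V)^{2/3} ≤ En`.  Composition of `aggNamed_staticA/B`, `aggNamed_movesA/B` (named rows) with
`aggCert27_8_scaled` (normalisation); the two concavity minorants of `S = Σ_T v^{2/3}` are
`rpow_sum_le_sum_rpow_twoThirds` / `sum_mul_rpow_le_sum_rpow_twoThirds`.
WHAT THIS IS NOT: the texture-level step (next file); F-C1 not moved.
-/

noncomputable section

namespace Summit.Ventures.Crystal3D.Theorems

open Finset
open Summit.Ventures.Crystal3D.Cruxes.PolycrystalWulffBound.PolyDensity (AggCert27_8)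

set_option maxHeartbeats 2000000 in  -- one composition step with ≈ 130 arguments
/-- **The aggregated LP bound at class level.**  See the module docstring. -/
theorem aggLP_bound (hC : AggCert27_8) {β : Type} [Fintype β] [DecidableEq β] (F Y : β → ℝ) (Acl : β → β → ℝ)
    (v : β → ℝ) (V En : ℝ) {a b c : β} (hab : a ≠ b) (hbc : b ≠ c) (hac : a ≠ c)
    (hVpos : 0 < V) (hv_nn : ∀ i, 0 ≤ v i) (hvcb : v c ≤ v b) (hvba : v b ≤ v a) (hdom : v a ≤ 17 / 20 * V)
    (htop : ∀ r ∈ Finset.univ \ ({a, b, c} : Finset β), v r ≤ v c) (hF_nn : ∀ i, 0 ≤ F i)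
    (hY_nn : ∀ i, 0 ≤ Y i) (hAcl_symm : ∀ i j, Acl i j = Acl j i)
    (hfloor : ∀ i, Real.sqrt 3 * Y i ≤ F i)
    (hshv_single : ∀ (i : β) (ε ρq Kq : ℝ), 0 < ε → ε < 5 → Real.sqrt (5 - ε) ≤ ρq → Kq + 8 * ε ^ 3 ≤ 32 → 0 ≤ Kq →
      3 * Kq ^ ((1 : ℝ) / 3) * (v i) ^ ((2 : ℝ) / 3) ≤ F i + ρq * ∑ l ∈ Finset.univ \ {i}, Acl i l)
    (hshv_pair : ∀ (i j : β) (ε ρq Kq : ℝ), 0 < ε → ε < 5 → Real.sqrt (5 - ε) ≤ ρq → Kq + 8 * ε ^ 3 ≤ 27.8 → 0 ≤ Kq →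
      3 * Kq ^ ((1 : ℝ) / 3) * (∑ k ∈ ({i, j} : Finset β), v k) ^ ((2 : ℝ) / 3) ≤
        (∑ k ∈ ({i, j} : Finset β), F k) + ρq * ∑ k ∈ ({i, j} : Finset β), ∑ l ∈ Finset.univ \ {i, j}, Acl k l)
    (hsingle0 : ∀ (i : β) (ρq : ℝ), Real.sqrt 5 ≤ ρq →
      3 * (32 : ℝ) ^ ((1 : ℝ) / 3) * (v i) ^ ((2 : ℝ) / 3) ≤ F i + ρq * ∑ l ∈ Finset.univ \ {i}, Acl i l)
    (hpair0 : ∀ (i j : β) (ρq : ℝ), Real.sqrt 5 ≤ ρq →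
      3 * (27.8 : ℝ) ^ ((1 : ℝ) / 3) * (∑ k ∈ ({i, j} : Finset β), v k) ^ ((2 : ℝ) / 3) ≤
        (∑ k ∈ ({i, j} : Finset β), F k) + ρq * ∑ k ∈ ({i, j} : Finset β), ∑ l ∈ Finset.univ \ {i, j}, Acl k l)
    (htriple0 : ∀ (i j k : β) (ρq : ℝ), Real.sqrt 5 ≤ ρq →
      3 * (23.6 : ℝ) ^ ((1 : ℝ) / 3) * (∑ l ∈ ({i, j, k} : Finset β), v l) ^ ((2 : ℝ) / 3) ≤
        (∑ l ∈ ({i, j, k} : Finset β), F l) + ρq * ∑ l ∈ ({i, j, k} : Finset β), ∑ l' ∈ Finset.univ \ {i, j, k}, Acl l l')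
    (hballP : ∀ (P : Finset β) (ρq Kq : ℝ), Real.sqrt 3 ≤ ρq → 0 ≤ Kq → Kq ≤ 4 * Real.sqrt 3 * Real.pi →
      3 * Kq ^ ((1 : ℝ) / 3) * (∑ i ∈ P, v i) ^ ((2 : ℝ) / 3) ≤ (∑ i ∈ P, F i) + ρq * ∑ i ∈ P, ∑ j ∈ Finset.univ \ P, Acl i j)
    (hisoP : ∀ P : Finset β, 3 * (Real.pi * 4 / 3) ^ ((1 : ℝ) / 3) * (∑ i ∈ P, v i) ^ ((2 : ℝ) / 3) ≤
      (∑ i ∈ P, Y i) + ∑ i ∈ P, ∑ j ∈ Finset.univ \ P, Acl i j)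
    (hsumP : ∀ (P : Finset β) (ε ρq Kq : ℝ), 0 < ε → ε < 5 → Real.sqrt (5 - ε) ≤ ρq → Kq + 8 * ε ^ 3 ≤ 32 → 0 ≤ Kq →
      3 * Kq ^ ((1 : ℝ) / 3) * (∑ i ∈ P, (v i) ^ ((2 : ℝ) / 3)) ≤ (∑ i ∈ P, F i) + ρq * ∑ i ∈ P, ∑ j ∈ Finset.univ \ {i}, Acl i j)
    (hsumP0 : ∀ (P : Finset β) (ρq : ℝ), Real.sqrt 5 ≤ ρq →
      3 * (32 : ℝ) ^ ((1 : ℝ) / 3) * (∑ i ∈ P, (v i) ^ ((2 : ℝ) / 3)) ≤ (∑ i ∈ P, F i) + ρq * ∑ i ∈ P, ∑ j ∈ Finset.univ \ {i}, Acl i j)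
    (hT : (Finset.univ \ ({a, b, c} : Finset β)).Nonempty)
    (hV : V = v a + v b + v c + ∑ r ∈ Finset.univ \ {a, b, c}, v r)
    (hAcl_nn : ∀ i j, i ≠ j → 0 ≤ Acl i j)
    (hE : (∑ i, F i) + (∑ i, ∑ j, (if i ≠ j then Acl i j / 2 else 0)) ≤ En)
    (hrec : ∀ (𝒮 : Finset β) (l : β), l ∉ 𝒮 → 𝒮.Nonempty →
      6 * (2 : ℝ) ^ ((1 : ℝ) / 3) * (Real.sqrt 2 * V) ^ ((2 : ℝ) / 3) ≤ En + (Real.sqrt 5 - Real.sqrt 3) * (∑ i ∈ 𝒮, Y i)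
        - (∑ i, ∑ j, (if ((i ∈ insert l 𝒮) ∧ (j ∈ insert l 𝒮)) ∧ i ≠ j then Acl i j / 2 else 0)))
    (hdel : ∀ (𝒮 : Finset β), 𝒮.Nonempty → (∃ l, l ∉ 𝒮) →
      6 * (2 : ℝ) ^ ((1 : ℝ) / 3) * (Real.sqrt 2 * (V - ∑ i ∈ 𝒮, v i)) ^ ((2 : ℝ) / 3) ≤ En - (∑ i ∈ 𝒮, F i)
        + (Real.sqrt 5 - 1) * (∑ i ∈ Finset.univ \ 𝒮, ∑ j ∈ 𝒮, Acl i j)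
        - (∑ i, ∑ j, (if ((i ∈ 𝒮) ∧ (j ∈ 𝒮)) ∧ i ≠ j then Acl i j / 2 else 0))) :
    6 * (2 : ℝ) ^ ((1 : ℝ) / 3) * (Real.sqrt 2 * V) ^ ((2 : ℝ) / 3) ≤ En := by
  obtain ⟨r_floor1, r_floor2, r_floor3, r_floorR, r_blk1e00, r_blk1e02, r_blk1e03, r_blk1e04, r_blk1e05, r_iso1,
    r_blk2e00, r_blk2e02, r_blk2e03, r_blk2e04, r_blk2e05, r_iso2, r_blk3e00, r_blk3e02, r_blk3e03, r_blk3e04,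
    r_blk3e05, r_iso3, r_ballR, r_Rsum_e00, r_Rsum_e02, r_Rsum_e03, r_Rsum_e04, r_Rsum_e05, r_isoR, r_isoRsum⟩ :=
    aggNamed_staticA F Y Acl v hab hbc hac hY_nn hAcl_symm hfloor hshv_single hsingle0 hballP hisoP hsumP hsumP0
  obtain ⟨r_blk12e00, r_blk12e02, r_blk12e03, r_blk12e04, r_blk12e05, r_iso12, r_blk13e00, r_blk13e02, r_blk13e03, r_blk13e04,
    r_blk13e05, r_iso13, r_ball1R, r_iso1R, r_blk23e00, r_blk23e02, r_blk23e03, r_blk23e04, r_blk23e05, r_iso23,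
    r_ball2R, r_iso2R, r_ball3R, r_iso3R, r_blk123e00, r_iso123, r_ball12R, r_iso12R, r_ball13R, r_iso13R,
    r_ball23R, r_iso23R, r_ball123R, r_iso123R⟩ :=
    aggNamed_staticB F Y Acl v hab hbc hac hAcl_symm hshv_pair hpair0 htriple0 hballP hisoP
  obtain ⟨r_E, r_rec1_2, r_rec1_3, r_del1, r_rec2_1, r_rec2_3, r_del2, r_rec3_1, r_rec3_2, r_del3,
    r_recR_1, r_recR_2, r_recR_3, r_delR, r_rec12_3, r_del12, r_rec13_2, r_del13⟩ :=
    aggNamed_movesA F Y Acl v V En hab hbc hac hT hV hY_nn hAcl_nn hAcl_symm hE hrec hdel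
  obtain ⟨r_rec1R_2, r_rec1R_3, r_del1R, r_rec23_1, r_del23, r_rec2R_1, r_rec2R_3, r_del2R, r_rec3R_1, r_rec3R_2,
    r_del3R, r_del123, r_rec12R_3, r_del12R, r_rec13R_2, r_del13R, r_rec23R_1, r_del23R⟩ :=
    aggNamed_movesB F Y Acl v V En hab hbc hac hT hV hY_nn hAcl_nn hAcl_symm hrec hdel
  -- non-negativity of the named variables
  have hTv : 0 ≤ ∑ r ∈ Finset.univ \ {a, b, c}, v r := Finset.sum_nonneg fun r _ => hv_nn r
  have hTF : 0 ≤ ∑ r ∈ Finset.univ \ {a, b, c}, F r := Finset.sum_nonneg fun r _ => hF_nn r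
  have hTY : 0 ≤ ∑ r ∈ Finset.univ \ {a, b, c}, Y r := Finset.sum_nonneg fun r _ => hY_nn r
  have hTa : 0 ≤ ∑ r ∈ Finset.univ \ {a, b, c}, Acl a r :=
    Finset.sum_nonneg fun r hr => hAcl_nn a r (by rintro rfl; simp at hr)
  have hTb : 0 ≤ ∑ r ∈ Finset.univ \ {a, b, c}, Acl b r :=
    Finset.sum_nonneg fun r hr => hAcl_nn b r (by rintro rfl; simp at hr)
  have hTc : 0 ≤ ∑ r ∈ Finset.univ \ {a, b, c}, Acl c r :=
    Finset.sum_nonneg fun r hr => hAcl_nn c r (by rintro rfl; simp at hr)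
  have hRR : 0 ≤ (∑ i ∈ Finset.univ \ {a, b, c}, ∑ j ∈ (Finset.univ \ {a, b, c}) \ {i}, Acl i j) / 2 :=
    div_nonneg (Finset.sum_nonneg fun i _ => Finset.sum_nonneg fun j hj =>
      hAcl_nn i j (by rintro rfl; simp at hj)) zero_le_two
  have hS0 : 0 ≤ ∑ r ∈ Finset.univ \ {a, b, c}, v r ^ ((2 : ℝ) / 3) :=
    Finset.sum_nonneg fun r _ => Real.rpow_nonneg (hv_nn r) _
  have hE0 : 0 ≤ En := by
    linarith only [r_E, hF_nn a, hF_nn b, hF_nn c, hTF, hAcl_nn a b hab, hAcl_nn a c hac, hAcl_nn b c hbc, hTa, hTb,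
      hTc, hRR]
  -- the two concavity minorants and the degenerate case
  have hS1 : (∑ r ∈ Finset.univ \ {a, b, c}, v r) ^ ((2 : ℝ) / 3) ≤ ∑ r ∈ Finset.univ \ {a, b, c}, v r ^ ((2 : ℝ) / 3) :=
    rpow_sum_le_sum_rpow_twoThirds _ v fun r _ => hv_nn r
  have hS2 : (∑ r ∈ Finset.univ \ {a, b, c}, v r) * v c ^ (-(1 : ℝ) / 3) ≤
      ∑ r ∈ Finset.univ \ {a, b, c}, v r ^ ((2 : ℝ) / 3) :=
    sum_mul_rpow_le_sum_rpow_twoThirds _ v (fun r _ => hv_nn r) htop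
  have hS3 : v c = 0 → (∑ r ∈ Finset.univ \ {a, b, c}, v r) = 0 := fun h0 =>
    Finset.sum_eq_zero fun r hr => le_antisymm (h0 ▸ htop r hr) (hv_nn r)
  exact aggCert27_8_scaled hC V (v a) (v b) (v c) (∑ r ∈ Finset.univ \ {a, b, c}, v r) En (F a) (F b) (F c)
    (∑ r ∈ Finset.univ \ {a, b, c}, F r) (Y a) (Y b) (Y c) (∑ r ∈ Finset.univ \ {a, b, c}, Y r) (Acl a b) (Acl a c)
    (∑ r ∈ Finset.univ \ {a, b, c}, Acl a r) (Acl b c) (∑ r ∈ Finset.univ \ {a, b, c}, Acl b r)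
    (∑ r ∈ Finset.univ \ {a, b, c}, Acl c r)
    ((∑ i ∈ Finset.univ \ {a, b, c}, ∑ j ∈ (Finset.univ \ {a, b, c}) \ {i}, Acl i j) / 2)
    (∑ r ∈ Finset.univ \ {a, b, c}, v r ^ ((2 : ℝ) / 3)) hVpos hV hTv (hv_nn c) hvcb hvba hdom hE0 (hF_nn a) (hF_nn b)
    (hF_nn c) hTF (hY_nn a) (hY_nn b) (hY_nn c) hTY (hAcl_nn a b hab) (hAcl_nn a c hac) hTa (hAcl_nn b c hbc) hTb hTc
    hRR hS0 hS1 hS2 hS3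
    r_E r_floor1 r_floor2 r_floor3 r_floorR r_blk1e00 r_blk1e02 r_blk1e03 r_blk1e04 r_blk1e05 r_iso1 r_blk2e00
    r_blk2e02 r_blk2e03 r_blk2e04 r_blk2e05 r_iso2 r_blk3e00 r_blk3e02 r_blk3e03 r_blk3e04 r_blk3e05 r_iso3 r_ballR
    r_Rsum_e00 r_Rsum_e02 r_Rsum_e03 r_Rsum_e04 r_Rsum_e05 r_isoR r_isoRsum r_blk12e00 r_blk12e02 r_blk12e03 r_blk12e04 r_blk12e05
    r_iso12 r_blk13e00 r_blk13e02 r_blk13e03 r_blk13e04 r_blk13e05 r_iso13 r_ball1R r_iso1R r_blk23e00 r_blk23e02 r_blk23e03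
    r_blk23e04 r_blk23e05 r_iso23 r_ball2R r_iso2R r_ball3R r_iso3R r_blk123e00 r_iso123 r_ball12R r_iso12R r_ball13R
    r_iso13R r_ball23R r_iso23R r_ball123R r_iso123R r_rec1_2 r_rec1_3 r_del1 r_rec2_1 r_rec2_3 r_del2 r_rec3_1
    r_rec3_2 r_del3 r_recR_1 r_recR_2 r_recR_3 r_delR r_rec12_3 r_del12 r_rec13_2 r_del13 r_rec1R_2 r_rec1R_3
    r_del1R r_rec23_1 r_del23 r_rec2R_1 r_rec2R_3 r_del2R r_rec3R_1 r_rec3R_2 r_del3R r_del123 r_rec12R_3 r_del12R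
    r_rec13R_2 r_del13R r_rec23R_1 r_del23R

end Summit.Ventures.Crystal3D.Theorems

end
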